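import Literature.Analysis.FluidPDE.FluidComputer.ThresholdTransferStage
import Literature.Analysis.FluidPDE.FluidComputer.ThresholdStages
import HarnessLib

/-!
# Fluid computer blueprint — threshold gate: the LAST STAGE as a certificate, and the FULL CYCLE

HONEST FRAMING: low prior, high value-of-information experiment on Tao's machine paradigm; NOT a
claim that NS blows up. Finite-dimensional ODE theory about the explicit five-mode threshold circuit
`thresholdCircuit` (`ThresholdGate.lean`) packaged in the reach layer's interface
`ReachCertificate` (`ReachCertificate.lean`); nothing is asserted about any fluid equation.

## What

* §1 `energyTube`, `outputLoaded`, `preloadTube`: the economical tube of the last stage (energy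
  drift `|E(X) - E(p)| ≤ 10δR_b·t` and the output floor `ã ≥ p₄ - δt`, both certified along every
  forced window), the target region `{ã² ≥ E_out}`, and the preload condition to be tracked
  through earlier stages (`ReachCertificate.withPreload`, an instance of `restrict`).
* §2 `transferStage`: stage 3 of the threshold gate — IGNITION + TRANSFER — as a
  `ReachCertificate (thresholdCircuit …) (modeBall R_b) δ T₃ Ain (outputLoaded E_out)`: AVOID is
  energy bookkeeping, REACH is `exists_output_loaded` (`ThresholdTransferStage.lean`); the
  hypotheses are its hypotheses required at every input readout `p ∈ Ain` (and its `hign` at every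
  ignition state of the boxes run from `p`).
* §3 `fullCycle`: ANY certificate `C₁₂` of the gate over the energy ball (e.g. stages 1–2,
  `preCrossCertificate` of `ThresholdStages.lean`) whose preload-refined hand-off region satisfies
  those hypotheses composes with stage 3 (`ReachCertificate.comp`; seams discharged here: canonical
  hand-off, compact hand-off tubes — closed slices of a closed graph inside the bounded ball —,
  jointly closed energy tubes) to ONE certificate of length `T₁₂ + T₃` from `Ain` to
  `outputLoaded E_out`; `fullCycle_reach` is its REACH with no region hypothesis.

So the threshold gate's cycle "loaded input ⟶ output loaded to level `E_out`, for every
`δ`-admissible forcing" is a theorem CONDITIONAL exactly on the listed closed-form inequalities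
among the design constants (none of which is verified here; the cell's ASSEMBLY.md §2k confronts
them with the calibration run). [cite: Tao2016AveragedNS, §5.5 Thm 5.3 (5.5); §1.3 pp. 10–11]
-/

noncomputable section

open Set Filter Topology
open scoped NNReal

namespace Literature.Analysis.FluidPDE.FluidComputer

open Literature.Analysis.FluidPDE.Tao2016AveragedNS Literature.Analysis.ODE

variable {ε σ ν μ r κ δ a₀ : ℝ}

/-! ### §1. The energy tube, the output-loaded region, the preload condition -/

/-- **Output loaded to level `E_out`**: `ã² ≥ E_out`. [folklore] -/
def outputLoaded (Eout : ℝ) : Set (Fin 5 → ℝ) := {X | Eout ≤ X 4 ^ 2}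

/-- **The energy tube** of the last stage run from `p`: energy drift at most `10δR_b·t` and output
at least `p₄ - δt`. [folklore] -/
def energyTube (δ Rb : ℝ) (p : Fin 5 → ℝ) (t : ℝ) : Set (Fin 5 → ℝ) :=
  {X | |energy X - energy p| ≤ 10 * (δ * Rb) * t ∧ p 4 - δ * t ≤ X 4}

/-- **The preload condition** tracked from `p`: output at least `p₄ - δσ`. [folklore] -/
def preloadTube (δ : ℝ) (p : Fin 5 → ℝ) (σ : ℝ) : Set (Fin 5 → ℝ) := {X | p 4 - δ * σ ≤ X 4}

/-- The energy tube starts at `p`. [folklore] -/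
theorem self_mem_energyTube_zero (δ Rb : ℝ) (p : Fin 5 → ℝ) : p ∈ energyTube δ Rb p 0 := by
  simp [energyTube]

/-- The energy is continuous. [folklore] -/
theorem continuous_energy_five : Continuous (energy : (Fin 5 → ℝ) → ℝ) := by
  unfold energy; fun_prop

/-- The energy tube has a closed graph over any time interval. [folklore] -/
theorem isClosed_energyTube_graph (δ Rb T : ℝ) (p : Fin 5 → ℝ) :
    IsClosed {z : ℝ × (Fin 5 → ℝ) | z.1 ∈ Icc 0 T ∧ z.2 ∈ energyTube δ Rb p z.1} := by
  have hEz : Continuous fun z : ℝ × (Fin 5 → ℝ) => energy z.2 :=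
    continuous_energy_five.comp continuous_snd
  have h4 : Continuous fun z : ℝ × (Fin 5 → ℝ) => z.2 4 := (continuous_apply 4).comp continuous_snd
  simp only [energyTube, Set.mem_Icc, Set.setOf_and]
  exact ((isClosed_le continuous_const continuous_fst).inter
    (isClosed_le continuous_fst continuous_const)).inter
    ((isClosed_le (by fun_prop) (by fun_prop)).inter (isClosed_le (by fun_prop) h4))

/-- The energy tubes are JOINTLY closed in (initial point `q ∈ K`, time, state) for every closed
`K` — the hypothesis `hjoint` of `ReachCertificate.comp`. [folklore] -/
theorem isClosed_energyTube_joint (δ Rb T : ℝ) {K : Set (Fin 5 → ℝ)} (hK : IsClosed K) :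
    IsClosed {z : (Fin 5 → ℝ) × (ℝ × (Fin 5 → ℝ)) | z.1 ∈ K ∧ z.2.1 ∈ Icc 0 T ∧
      z.2.2 ∈ energyTube δ Rb z.1 z.2.1} := by
  have hEq : Continuous fun z : (Fin 5 → ℝ) × (ℝ × (Fin 5 → ℝ)) => energy z.1 :=
    continuous_energy_five.comp continuous_fst
  have hEX : Continuous fun z : (Fin 5 → ℝ) × (ℝ × (Fin 5 → ℝ)) => energy z.2.2 :=
    continuous_energy_five.comp (continuous_snd.comp continuous_snd)
  have ht : Continuous fun z : (Fin 5 → ℝ) × (ℝ × (Fin 5 → ℝ)) => z.2.1 :=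
    continuous_fst.comp continuous_snd
  have hq4 : Continuous fun z : (Fin 5 → ℝ) × (ℝ × (Fin 5 → ℝ)) => z.1 4 :=
    (continuous_apply 4).comp continuous_fst
  have hX4 : Continuous fun z : (Fin 5 → ℝ) × (ℝ × (Fin 5 → ℝ)) => z.2.2 4 :=
    (continuous_apply 4).comp (continuous_snd.comp continuous_snd)
  have hKz : IsClosed {z : (Fin 5 → ℝ) × (ℝ × (Fin 5 → ℝ)) | z.1 ∈ K} :=
    hK.preimage continuous_fst
  simp only [energyTube, Set.mem_Icc, Set.setOf_and]
  exact hKz.inter (((isClosed_le continuous_const ht).inter (isClosed_le ht continuous_const)).inter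
    ((isClosed_le (by fun_prop) (by fun_prop)).inter (isClosed_le (by fun_prop) hX4)))

/-- The energy tube lies in the energy ball once `E(p) + 10δR_b·T < R_b²`. [folklore] -/
theorem energyTube_subset_modeBall {δ Rb T t : ℝ} {p : Fin 5 → ℝ} (hRb : 0 ≤ Rb) (hδ : 0 ≤ δ)
    (ht : t ∈ Icc 0 T) (hE : energy p + 10 * (δ * Rb) * T < Rb ^ 2) :
    energyTube δ Rb p t ⊆ modeBall Rb := by
  intro X hX i
  have h1 := (abs_le.1 hX.1).2
  have h2 : 10 * (δ * Rb) * t ≤ 10 * (δ * Rb) * T := mul_le_mul_of_nonneg_left ht.2 (by positivity)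
  have h3 : X i ^ 2 < Rb ^ 2 := lt_of_le_of_lt (sq_apply_le_energy X i) (by linarith)
  exact abs_lt_of_sq_lt_sq h3 hRb

/-- **Membership along forced windows**: every forced window of the threshold circuit with
`|xᵢ| ≤ R_b` lies in the energy tube run from its start (`energy_abs_sub_le`, `output_ge_affine`).
[folklore] -/
theorem IsForcedWindow.mem_energyTube {τ : ℝ} {x : ℝ → Fin 5 → ℝ}
    (h : IsForcedWindow ε σ ν μ r κ δ τ x) (hκ : 0 ≤ κ) {Rb : ℝ} (hRb : 0 ≤ Rb)
    (hU : ∀ t ∈ Ico 0 τ, ∀ i, |x t i| ≤ Rb) : ∀ t ∈ Icc 0 τ, x t ∈ energyTube δ Rb (x 0) t :=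
  fun t ht => ⟨h.energy_abs_sub_le hRb hU t ht, h.output_ge_affine hκ t ht⟩

namespace ReachCertificate

variable {U : Set (Fin 5 → ℝ)} {τc : ℝ} {Ain Aout : Set (Fin 5 → ℝ)}

/-- **Tracking the preload**: any certificate of the threshold gate has its tube refined by the
output floor `ã ≥ p₄ - δσ` (`output_ge_affine` along admissible curves; `κ ≥ 0`). [folklore] -/
def withPreload (Cst : ReachCertificate (thresholdCircuit ε σ ν μ r κ) U δ τc Ain Aout)
    (hκ : 0 ≤ κ) :
    ReachCertificate (thresholdCircuit ε σ ν μ r κ) U δ τc Ain Aout :=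
  Cst.restrict (fun p σ' => preloadTube δ p σ')
    (fun p _ => by
      have h4 : Continuous fun z : ℝ × (Fin 5 → ℝ) => z.2 4 :=
        (continuous_apply 4).comp continuous_snd
      simp only [preloadTube, Set.mem_Icc, Set.setOf_and, Set.mem_setOf_eq]
      exact ((isClosed_le continuous_const continuous_fst).inter
        (isClosed_le continuous_fst continuous_const)).inter (isClosed_le (by fun_prop) h4))
    (fun p _ => by simp [preloadTube])
    (fun p _ σT x h0 _ hx0 hcont _ hder => by
      have hW : IsForcedWindow ε σ ν μ r κ δ σT x := ⟨hcont, hder⟩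
      have := hW.output_ge_affine hκ σT ⟨h0, le_rfl⟩
      rw [hx0] at this
      exact this)

/-- Its tube (definitional unfolding). [folklore] -/
theorem withPreload_tube (Cst : ReachCertificate (thresholdCircuit ε σ ν μ r κ) U δ τc Ain Aout)
    (hκ : 0 ≤ κ) (p : Fin 5 → ℝ) (σ' : ℝ) :
    (Cst.withPreload hκ).Tube p σ' = Cst.Tube p σ' ∩ preloadTube δ p σ' := rfl

/-- The canonical hand-off region of the preload-refined certificate: end-of-stage tube points
whose output is at least the input's minus `δτ`. [folklore] -/
theorem mem_handoff_withPreload_iff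
    (Cst : ReachCertificate (thresholdCircuit ε σ ν μ r κ) U δ τc Ain Aout) (hκ : 0 ≤ κ)
    (X : Fin 5 → ℝ) :
    X ∈ (Cst.withPreload hκ).handoff ↔ ∃ p ∈ Ain, X ∈ Cst.Tube p τc ∧ p 4 - δ * τc ≤ X 4 :=
  Iff.rfl

/-- **Tubes over the energy ball are compact**: a closed slice of the closed graph, inside the
bounded ball. [folklore] -/
theorem isCompact_tube_of_modeBall {Rb : ℝ}
    (Cst : ReachCertificate (thresholdCircuit ε σ ν μ r κ) (modeBall Rb) δ τc Ain Aout)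
    (hRb : 0 ≤ Rb) {p : Fin 5 → ℝ} (hp : p ∈ Ain) {σ' : ℝ} (hσ : σ' ∈ Icc 0 τc) :
    IsCompact (Cst.Tube p σ') := by
  have hcl : IsClosed (Cst.Tube p σ') := by
    have hgr := Cst.Tube_closed p hp
    have hc : Continuous fun X : Fin 5 → ℝ => ((σ', X) : ℝ × (Fin 5 → ℝ)) := by fun_prop
    have hEq : Cst.Tube p σ' = (fun X : Fin 5 → ℝ => ((σ', X) : ℝ × (Fin 5 → ℝ))) ⁻¹'
        {z : ℝ × (Fin 5 → ℝ) | z.1 ∈ Icc 0 τc ∧ z.2 ∈ Cst.Tube p z.1} := by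
      ext X
      simp only [Set.mem_preimage, Set.mem_setOf_eq]
      exact ⟨fun h => ⟨hσ, h⟩, fun h => h.2⟩
    rw [hEq]
    exact hgr.preimage hc
  have hbd : Bornology.IsBounded (Cst.Tube p σ') := by
    refine (Metric.isBounded_closedBall (x := (0 : Fin 5 → ℝ)) (r := Rb)).subset ?_
    intro X hX
    have hXU : X ∈ modeBall Rb := Cst.Tube_sub p hp σ' hσ hX
    rw [mem_closedBall_zero_iff]
    exact (pi_norm_le_iff_of_nonneg hRb).2 fun i => by
      rw [Real.norm_eq_abs]; exact (hXU i).le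
  exact Metric.isCompact_of_isClosed_isBounded hcl hbd

end ReachCertificate

/-! ### §2. Stage 3 — ignition + transfer — as a certificate over the energy ball -/

/-- **STAGE 3 OF THE THRESHOLD GATE AS A REACH CERTIFICATE.** Working region the energy ball
`modeBall R_b`, defect level `δ`, length `T₃`, input region any `Ain` at whose points the hypotheses
of `exists_output_loaded` hold (`hAin`: loaded `a ≥ a₁`, un-ignited `0 ≤ c < C`, output preload
`ã ≥ δT₃`, energy inside the ball over `T₃`, the carrier/energy inequality `hEa`, clock past the
band and stage longer than the ignition time; `hign`: the six clock-side / conversion inequalities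
at every ignition state of the boxes run from `p`), output region `outputLoaded E_out`. Tube: the
energy tube.
AVOID is energy bookkeeping; REACH is `exists_output_loaded`. [cite: Tao2016AveragedNS, §5.5
Thm 5.3 (5.5)] -/
def transferStage (ε σ ν μ r κ δ a₀ a₁ C Rb T₃ Tig c₀ Cm B Θd TA β lam u₀ L Eout : ℝ)
    (Ain : Set (Fin 5 → ℝ))
    (hε : 0 ≤ ε) (hσ : 0 ≤ σ) (hν : 0 ≤ ν) (hμ : 0 ≤ μ) (hr : 0 < r) (hκ : 0 < κ) (hδ : 0 ≤ δ)
    (hRb : 0 ≤ Rb) (ha₀ : 0 ≤ a₀) (ha₁ : a₀ < a₁) (hTig : 0 < Tig) (hT₃ : Tig < T₃)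
    (hc₀ : 0 < c₀) (hCm0 : 0 ≤ Cm) (hB0 : 0 ≤ B) (hΘd : 0 < Θd) (hTA : 0 ≤ TA) (hβ0 : 0 < β)
    (hβ1 : β ≤ 1) (hlam0 : 0 ≤ lam) (hlam : lam ≤ β / 4) (hu₀ : 0 ≤ u₀)
    (hs : δ < σ * a₀ ^ 2) (hbal : ν * C ^ 2 + δ ≤ ε * a₀ ^ 2)
    (hfloor : c₀ + δ * (T₃ - Tig) < C) (hlong : r * Cm * TA + Θd ≤ r * c₀ * (T₃ - Tig))
    (hCm : C + ((ν * B + μ * Rb) / r + (σ * Rb ^ 2 + δ) / (r * c₀)) * (r * Cm * TA + Θd) < Cm)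
    (hLfloor : β * (r * Cm) + κ * δ * (T₃ - Tig) ≤ L) (hLceil : L ≤ r * c₀)
    (hceil : β * (κ * Rb) ≤ 2 * (r * c₀))
    (hAin : ∀ p ∈ Ain, a₁ ≤ p 0 ∧ 0 ≤ p 2 ∧ p 2 < C ∧ δ * T₃ ≤ p 4 ∧
      energy p + 10 * (δ * Rb) * T₃ < Rb ^ 2 ∧
      a₁ ^ 2 + 10 * (δ * Rb) * Tig +
        max |p 1 - (ν * C ^ 2 + δ) * Tig| |p 1 + (ε * Rb ^ 2 + δ) * Tig| ^ 2 + C ^ 2 +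
        (Real.sqrt (p 3 ^ 2 + p 4 ^ 2) + (r * Rb * C + 2 * δ) * Tig) ^ 2 < energy p ∧
      0 < ν * p 1 - μ * Rb ∧
      Real.log (1 + (ν * p 1 - μ * Rb) * C / (σ * a₀ ^ 2 - δ)) / (ν * p 1 - μ * Rb) < Tig)
    (hign : ∀ p ∈ Ain, ∀ t ∈ Icc 0 Tig, ∀ Y ∈ boxTube ε ν r δ a₁ Rb C p t, Y 2 = C →
      (∀ i, |Y i| ≤ Rb) →
      Y 1 + (ε * Rb ^ 2 + δ) * (T₃ - Tig) ≤ B ∧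
      0 ≤ Y 1 - ν * Cm / r * (r * Cm * TA + Θd) - δ * (T₃ - Tig) ∧
      μ ^ 2 * (Y 0 ^ 2 + Y 3 ^ 2 + 2 * μ * Rb * Cm / r * (r * Cm * TA + Θd) +
          4 * (Rb * δ) * (T₃ - Tig)) ≤
        ν ^ 2 * (Y 1 - ν * Cm / r * (r * Cm * TA + Θd) - δ * (T₃ - Tig)) ^ 2 ∧
      u₀ ≤ energy Y - 10 * (δ * Rb) * (T₃ - Tig) - B ^ 2 - Cm ^ 2 - (L / κ) ^ 2 ∧
      L ≤ κ * (Y 4 - κ / (r * Cm) * Rb ^ 2 +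
        κ / (r * Cm) / 2 * ((1 - 1 / 2) * u₀) * (r * c₀ * TA) -
        (κ / (r * Cm) * Rb * (ε * Rb ^ 2 + σ * Rb * Cm + μ * Cm ^ 2 + δ) + δ) * TA) ∧
      Eout ≤ energy Y - 10 * (δ * Rb) * (T₃ - Tig) - B ^ 2 - Cm ^ 2 -
        Real.exp (-lam * Θd) * ((1 + β / 2) * (energy Y + 10 * (δ * Rb) * (T₃ - Tig)) +
          8 * Rb * (ε * Rb ^ 2 + σ * Rb * Cm + μ * Cm ^ 2 + δ) *
            Real.exp (lam * (r * Cm * TA + Θd)) * (T₃ - Tig)) / (1 - β / 2)) :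
    ReachCertificate (thresholdCircuit ε σ ν μ r κ) (modeBall Rb) δ T₃ Ain (outputLoaded Eout) where
  Tube p t := energyTube δ Rb p t
  Tube_closed p _ := isClosed_energyTube_graph δ Rb T₃ p
  Tube_zero p _ := self_mem_energyTube_zero δ Rb p
  Tube_sub p hp t ht := energyTube_subset_modeBall hRb hδ ht (hAin p hp).2.2.2.2.1
  cert p hp σT x h0 hσT hx0 hcont hU hder := by
    have hW : IsForcedWindow ε σ ν μ r κ δ σT x := ⟨hcont, hder⟩
    have hUlt : ∀ t ∈ Ico 0 σT, ∀ i, |x t i| < Rb := fun t ht i =>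
      (show ∀ j, |x t j| < Rb from hU t ht) i
    refine ⟨?_, fun hEq => ?_⟩
    · rw [← hx0]
      exact hW.mem_energyTube hκ.le hRb (fun t ht i => (hUlt t ht i).le) σT ⟨h0, le_rfl⟩
    · subst hEq
      subst hx0
      obtain ⟨ha, hc0, hc0C, hpre, hER, hEa, hρ₁, hτ⟩ := hAin (x 0) hp
      have hTig' : 10 * (δ * Rb) * Tig ≤ 10 * (δ * Rb) * σT :=
        mul_le_mul_of_nonneg_left hT₃.le (by positivity)
      have hER' : energy (x 0) + 10 * (δ * Rb) * Tig < Rb ^ 2 := by linarith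
      obtain ⟨t, ht, hout⟩ := exists_output_loaded (a₀ := a₀) hε hσ hν hμ hr hκ hδ hRb ha₀ ha₁
        hTig hT₃ hc₀ hCm0 hB0 hΘd hTA hβ0 hβ1 hlam0 hlam hu₀ hcont hUlt hder ha hc0 hc0C hs hER'
        hEa hbal hρ₁ hτ hpre hfloor hlong hCm hLfloor hLceil hceil (hign (x 0) hp)
      exact ⟨t, ht, hout⟩

/-! ### §3. The full cycle: any earlier-stage certificate over the ball, then stage 3 -/

/-- **THE FULL CYCLE OF THE THRESHOLD GATE AS ONE CERTIFICATE.** Let `C₁₂` be any certificate of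
the gate over the energy ball `modeBall R_b`, defect `δ`, length `T₁₂ ≥ 0`, from `Ain` (e.g. stages
1–2, `preCrossCertificate`). Refine it by the preload (`withPreload`), retarget it to its canonical
hand-off region `H` (`toHandoff`), and assume the stage-3 hypotheses at every point of `H`. Then
`C₁₂` followed by `transferStage` is a `ReachCertificate` of length `T₁₂ + T₃` from `Ain` to
`outputLoaded E_out` (`ReachCertificate.comp`: hand-off by construction, compact hand-off tubes by
`isCompact_tube_of_modeBall`, joint closedness by `isClosed_energyTube_joint`).
[cite: Tao2016AveragedNS, §5.5 Thm 5.3 (5.5); §1.3 pp. 10–11] -/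
def fullCycle {T₁₂ : ℝ} {Ain Amid : Set (Fin 5 → ℝ)}
    (ε σ ν μ r κ δ a₀ a₁ C Rb T₃ Tig c₀ Cm B Θd TA β lam u₀ L Eout : ℝ)
    (C₁₂ : ReachCertificate (thresholdCircuit ε σ ν μ r κ) (modeBall Rb) δ T₁₂ Ain Amid)
    (hT₁₂ : 0 ≤ T₁₂)
    (hε : 0 ≤ ε) (hσ : 0 ≤ σ) (hν : 0 ≤ ν) (hμ : 0 ≤ μ) (hr : 0 < r) (hκ : 0 < κ) (hδ : 0 ≤ δ)
    (hRb : 0 ≤ Rb) (ha₀ : 0 ≤ a₀) (ha₁ : a₀ < a₁) (hTig : 0 < Tig) (hT₃ : Tig < T₃)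
    (hc₀ : 0 < c₀) (hCm0 : 0 ≤ Cm) (hB0 : 0 ≤ B) (hΘd : 0 < Θd) (hTA : 0 ≤ TA) (hβ0 : 0 < β)
    (hβ1 : β ≤ 1) (hlam0 : 0 ≤ lam) (hlam : lam ≤ β / 4) (hu₀ : 0 ≤ u₀)
    (hs : δ < σ * a₀ ^ 2) (hbal : ν * C ^ 2 + δ ≤ ε * a₀ ^ 2)
    (hfloor : c₀ + δ * (T₃ - Tig) < C) (hlong : r * Cm * TA + Θd ≤ r * c₀ * (T₃ - Tig))
    (hCm : C + ((ν * B + μ * Rb) / r + (σ * Rb ^ 2 + δ) / (r * c₀)) * (r * Cm * TA + Θd) < Cm)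
    (hLfloor : β * (r * Cm) + κ * δ * (T₃ - Tig) ≤ L) (hLceil : L ≤ r * c₀)
    (hceil : β * (κ * Rb) ≤ 2 * (r * c₀))
    (hAin : ∀ p ∈ (C₁₂.withPreload hκ.le).handoff, a₁ ≤ p 0 ∧ 0 ≤ p 2 ∧ p 2 < C ∧ δ * T₃ ≤ p 4 ∧
      energy p + 10 * (δ * Rb) * T₃ < Rb ^ 2 ∧
      a₁ ^ 2 + 10 * (δ * Rb) * Tig +
        max |p 1 - (ν * C ^ 2 + δ) * Tig| |p 1 + (ε * Rb ^ 2 + δ) * Tig| ^ 2 + C ^ 2 +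
        (Real.sqrt (p 3 ^ 2 + p 4 ^ 2) + (r * Rb * C + 2 * δ) * Tig) ^ 2 < energy p ∧
      0 < ν * p 1 - μ * Rb ∧
      Real.log (1 + (ν * p 1 - μ * Rb) * C / (σ * a₀ ^ 2 - δ)) / (ν * p 1 - μ * Rb) < Tig)
    (hign : ∀ p ∈ (C₁₂.withPreload hκ.le).handoff, ∀ t ∈ Icc 0 Tig,
      ∀ Y ∈ boxTube ε ν r δ a₁ Rb C p t, Y 2 = C → (∀ i, |Y i| ≤ Rb) →
      Y 1 + (ε * Rb ^ 2 + δ) * (T₃ - Tig) ≤ B ∧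
      0 ≤ Y 1 - ν * Cm / r * (r * Cm * TA + Θd) - δ * (T₃ - Tig) ∧
      μ ^ 2 * (Y 0 ^ 2 + Y 3 ^ 2 + 2 * μ * Rb * Cm / r * (r * Cm * TA + Θd) +
          4 * (Rb * δ) * (T₃ - Tig)) ≤
        ν ^ 2 * (Y 1 - ν * Cm / r * (r * Cm * TA + Θd) - δ * (T₃ - Tig)) ^ 2 ∧
      u₀ ≤ energy Y - 10 * (δ * Rb) * (T₃ - Tig) - B ^ 2 - Cm ^ 2 - (L / κ) ^ 2 ∧
      L ≤ κ * (Y 4 - κ / (r * Cm) * Rb ^ 2 +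
        κ / (r * Cm) / 2 * ((1 - 1 / 2) * u₀) * (r * c₀ * TA) -
        (κ / (r * Cm) * Rb * (ε * Rb ^ 2 + σ * Rb * Cm + μ * Cm ^ 2 + δ) + δ) * TA) ∧
      Eout ≤ energy Y - 10 * (δ * Rb) * (T₃ - Tig) - B ^ 2 - Cm ^ 2 -
        Real.exp (-lam * Θd) * ((1 + β / 2) * (energy Y + 10 * (δ * Rb) * (T₃ - Tig)) +
          8 * Rb * (ε * Rb ^ 2 + σ * Rb * Cm + μ * Cm ^ 2 + δ) *
            Real.exp (lam * (r * Cm * TA + Θd)) * (T₃ - Tig)) / (1 - β / 2)) :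
    ReachCertificate (thresholdCircuit ε σ ν μ r κ) (modeBall Rb) δ (T₁₂ + T₃) Ain
      (outputLoaded Eout) :=
  ((C₁₂.withPreload hκ.le).toHandoff hT₁₂).comp
    (transferStage ε σ ν μ r κ δ a₀ a₁ C Rb T₃ Tig c₀ Cm B Θd TA β lam u₀ L Eout
      (C₁₂.withPreload hκ.le).handoff hε hσ hν hμ hr hκ hδ hRb ha₀ ha₁ hTig hT₃ hc₀ hCm0 hB0 hΘd hTA
      hβ0 hβ1 hlam0 hlam hu₀ hs hbal hfloor hlong hCm hLfloor hLceil hceil hAin hign)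
    hT₁₂ (hTig.trans hT₃)
    (fun _ hp => (C₁₂.withPreload hκ.le).tube_subset_handoff hp)
    (fun _ hp => (C₁₂.withPreload hκ.le).isCompact_tube_of_modeBall hRb hp ⟨hT₁₂, le_rfl⟩)
    (fun _ hp => isClosed_energyTube_joint δ Rb T₃
      (((C₁₂.withPreload hκ.le).isCompact_tube_of_modeBall hRb hp ⟨hT₁₂, le_rfl⟩).isClosed))

/-- **REACH OF THE FULL CYCLE, with no region hypothesis**: every continuous curve from `p ∈ Ain`
with a `δ`-admissible right derivative for the threshold gate on `[0, T₁₂ + T₃)` has its output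
loaded to the level `E_out` at some time of `[0, T₁₂ + T₃]` — for EVERY admissible forcing.
[cite: Tao2016AveragedNS, §5.5 Thm 5.3 (5.5)] -/
theorem fullCycle_reach {T₁₂ : ℝ} {Ain Amid : Set (Fin 5 → ℝ)}
    (ε σ ν μ r κ δ a₀ a₁ C Rb T₃ Tig c₀ Cm B Θd TA β lam u₀ L Eout : ℝ)
    (C₁₂ : ReachCertificate (thresholdCircuit ε σ ν μ r κ) (modeBall Rb) δ T₁₂ Ain Amid)
    (hT₁₂ : 0 ≤ T₁₂)
    (hε : 0 ≤ ε) (hσ : 0 ≤ σ) (hν : 0 ≤ ν) (hμ : 0 ≤ μ) (hr : 0 < r) (hκ : 0 < κ) (hδ : 0 ≤ δ)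
    (hRb : 0 ≤ Rb) (ha₀ : 0 ≤ a₀) (ha₁ : a₀ < a₁) (hTig : 0 < Tig) (hT₃ : Tig < T₃)
    (hc₀ : 0 < c₀) (hCm0 : 0 ≤ Cm) (hB0 : 0 ≤ B) (hΘd : 0 < Θd) (hTA : 0 ≤ TA) (hβ0 : 0 < β)
    (hβ1 : β ≤ 1) (hlam0 : 0 ≤ lam) (hlam : lam ≤ β / 4) (hu₀ : 0 ≤ u₀)
    (hs : δ < σ * a₀ ^ 2) (hbal : ν * C ^ 2 + δ ≤ ε * a₀ ^ 2)
    (hfloor : c₀ + δ * (T₃ - Tig) < C) (hlong : r * Cm * TA + Θd ≤ r * c₀ * (T₃ - Tig))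
    (hCm : C + ((ν * B + μ * Rb) / r + (σ * Rb ^ 2 + δ) / (r * c₀)) * (r * Cm * TA + Θd) < Cm)
    (hLfloor : β * (r * Cm) + κ * δ * (T₃ - Tig) ≤ L) (hLceil : L ≤ r * c₀)
    (hceil : β * (κ * Rb) ≤ 2 * (r * c₀))
    (hAin : ∀ p ∈ (C₁₂.withPreload hκ.le).handoff, a₁ ≤ p 0 ∧ 0 ≤ p 2 ∧ p 2 < C ∧ δ * T₃ ≤ p 4 ∧
      energy p + 10 * (δ * Rb) * T₃ < Rb ^ 2 ∧
      a₁ ^ 2 + 10 * (δ * Rb) * Tig +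
        max |p 1 - (ν * C ^ 2 + δ) * Tig| |p 1 + (ε * Rb ^ 2 + δ) * Tig| ^ 2 + C ^ 2 +
        (Real.sqrt (p 3 ^ 2 + p 4 ^ 2) + (r * Rb * C + 2 * δ) * Tig) ^ 2 < energy p ∧
      0 < ν * p 1 - μ * Rb ∧
      Real.log (1 + (ν * p 1 - μ * Rb) * C / (σ * a₀ ^ 2 - δ)) / (ν * p 1 - μ * Rb) < Tig)
    (hign : ∀ p ∈ (C₁₂.withPreload hκ.le).handoff, ∀ t ∈ Icc 0 Tig,
      ∀ Y ∈ boxTube ε ν r δ a₁ Rb C p t, Y 2 = C → (∀ i, |Y i| ≤ Rb) →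
      Y 1 + (ε * Rb ^ 2 + δ) * (T₃ - Tig) ≤ B ∧
      0 ≤ Y 1 - ν * Cm / r * (r * Cm * TA + Θd) - δ * (T₃ - Tig) ∧
      μ ^ 2 * (Y 0 ^ 2 + Y 3 ^ 2 + 2 * μ * Rb * Cm / r * (r * Cm * TA + Θd) +
          4 * (Rb * δ) * (T₃ - Tig)) ≤
        ν ^ 2 * (Y 1 - ν * Cm / r * (r * Cm * TA + Θd) - δ * (T₃ - Tig)) ^ 2 ∧
      u₀ ≤ energy Y - 10 * (δ * Rb) * (T₃ - Tig) - B ^ 2 - Cm ^ 2 - (L / κ) ^ 2 ∧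
      L ≤ κ * (Y 4 - κ / (r * Cm) * Rb ^ 2 +
        κ / (r * Cm) / 2 * ((1 - 1 / 2) * u₀) * (r * c₀ * TA) -
        (κ / (r * Cm) * Rb * (ε * Rb ^ 2 + σ * Rb * Cm + μ * Cm ^ 2 + δ) + δ) * TA) ∧
      Eout ≤ energy Y - 10 * (δ * Rb) * (T₃ - Tig) - B ^ 2 - Cm ^ 2 -
        Real.exp (-lam * Θd) * ((1 + β / 2) * (energy Y + 10 * (δ * Rb) * (T₃ - Tig)) +
          8 * Rb * (ε * Rb ^ 2 + σ * Rb * Cm + μ * Cm ^ 2 + δ) *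
            Real.exp (lam * (r * Cm * TA + Θd)) * (T₃ - Tig)) / (1 - β / 2))
    {p : Fin 5 → ℝ} (hp : p ∈ Ain) {x : ℝ → Fin 5 → ℝ} (hx0 : x 0 = p)
    (hcont : ContinuousOn x (Icc 0 (T₁₂ + T₃)))
    (hder : ∀ s ∈ Ico 0 (T₁₂ + T₃), ∃ W : Fin 5 → ℝ, HasDerivWithinAt x W (Ici s) s ∧
      ‖W - thresholdCircuit ε σ ν μ r κ (x s)‖ ≤ δ) :
    ∃ s ∈ Icc 0 (T₁₂ + T₃), Eout ≤ x s 4 ^ 2 :=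
  (fullCycle ε σ ν μ r κ δ a₀ a₁ C Rb T₃ Tig c₀ Cm B Θd TA β lam u₀ L Eout C₁₂ hT₁₂ hε hσ hν hμ hr
    hκ hδ hRb ha₀ ha₁ hTig hT₃ hc₀ hCm0 hB0 hΘd hTA hβ0 hβ1 hlam0 hlam hu₀ hs hbal hfloor hlong hCm
    hLfloor hLceil hceil hAin hign).reach (isOpen_modeBall Rb) hp
    (by linarith) hx0 hcont hder

end Literature.Analysis.FluidPDE.FluidComputer

end
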